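import Mathlib.Combinatorics.SetFamily.FourFunctions
import Mathlib.Data.Real.Basic
import Mathlib.Data.Sym.Sym2
import Mathlib.Algebra.Order.Field.Basic
import Mathlib.Tactic.Linarith
import Mathlib.Tactic.Ring
import Mathlib.Tactic.NormNum
import HarnessLib
import Summits.CriticalPhenomena.PercolationContinuityZ3.Theorems.PercNearOneGluingNoHeavyLowerTailKnQuestion8CoefficientwiseLeafNA

/-!
# FKG on the lattice of `x–z` cuts: the mixture lemma and submodularity of the edge boundary

Support file (`--supports stmt-CriticalPhenomena-4575`, closed), prover `prim-cplus-coupling` (gen 25).  Memo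
`prim-cplus-coupling/A5-COUPLING-gen25.md` §2 ("the `(q_R, q_B)` family and the cut representation").  No named facts, no sorries,
standard axioms; the only definitions are local notations.

Context.  The two-colouring conjectures of the antipodal-BHK programme (ALPHA1 = positive association of the red cluster of `x`
under the uniform measure on two-colourings with no red and no blue `x–z` path) sit at the corner `q_R = q_B = 1` of a family of
measures `1_T(r) q_R^{k(r)} q_B^{k(r̄)}`; for `q = 2` the factor `2^{k(r̄)}` on `{x ↮_blue z}` equals `4·#{S ∋ x, S ∌ z : ∂S ⊆ r}`
(the number of RED CUTS), so the `q = 2` measures are uniform measures on pairs (cut, colouring), i.e. mixtures — indexed by the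
distributive lattice of vertex sets `S` with `x ∈ S`, `z ∉ S` — of product measures.  Positive association of such a mixture follows
from three ingredients (van den Berg–Häggström–Kahn 2006, Lemma 2.6): each fibre is positively associated, the fibre means are
monotone in `S`, and the mixing weight is log-supermodular on the lattice.  This file proves the two model-independent ingredients:

* `CutLatticeFKG.fkg_mixture` — the **mixture lemma** in finite-sum form: for a log-supermodular weight `w ≥ 0` on a finite
  distributive lattice, nonnegative kernels `P a` on a finite fibre type whose fibre sums satisfy the (normalised) positive-association
  inequality, and two nonnegative fibre-dependent observables whose fibre means are monotone in `a`, the mixture satisfies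
  `(Σ_a w_a E_a F_a)(Σ_a w_a E_a G_a) ≤ (Σ_a w_a)(Σ_a w_a E_a[F_a G_a])`.  (Mathlib's `fkg` = the four functions theorem does the work;
  `harris_cube` is the product-measure fibre case.)
* `CutLatticeFKG.card_boundary_union_add_card_boundary_inter_le` — **submodularity of the edge boundary** of a finite multigraph
  `ends : ι → Sym2 V`: `#∂(S ∪ T) + #∂(S ∩ T) ≤ #∂S + #∂T`; hence `cutWeight_logSupermodular` / `cutWeightF_logSupermodular`: the
  weight `S ↦ 1[x ∈ S, z ∉ S (, ∂S ∩ ∂S' = ∅)]·(2^{#∂S})⁻¹` (the mass of the cylinder "all edges of `∂S` blue") is log-supermodular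
  on `Finset V` — the hypothesis of `fkg` / `fkg_mixture` for the cut lattice.
* `CutLatticeFKG.cutMixture_pa` — the **cut-mixture theorem**: for a fixed red cut `S'` and monotone `u, y ≥ 0`, the red cluster
  `K_S(t) = cl((t ∪ ∂S') ∩ E[S], x)` is positively associated under the mixture over blue cuts `S` (weight `2^{-#∂S}`, compatible
  with `S'`) of the uniform measures on colourings `t` — i.e. under the colouring measure `∝ 1[x ↮_red z] 2^{k(red)} 1[∂S' red]`
  (`2^{k(r)-2}` = number of blue cuts of `r`): the `q = 2`, `p = ½` case of van den Berg–Häggström–Kahn's random-cluster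
  Theorem 2.1 for the cluster of `x`, here with a forced-red cut, proved by FKG on the cut lattice instead of their Markov chain.
  This is the corner `(q_R, q_B) = (2, red cut fixed)` of the family of memo §2; the corner `(1, 1)` is conjecture ALPHA1.

[cite: VandenbergHaggstromKahn2005, Lemma 2.6 (p. 10) and Thm. 2.1 (p. 9)]; context [cite: KozmaNitzan2024, §5.5 (p. 36)].
-/

noncomputable section

open Finset
open scoped Classical

namespace Summit.CriticalPhenomena.PercolationContinuityZ3.Theorems

namespace CutLatticeFKG

/-! ### The mixture lemma -/

/-- **Mixture lemma (van den Berg–Häggström–Kahn 2006, Lemma 2.6, finite-sum form).**  `α` a finite distributive lattice (the index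
of the fibres), `Ω` a finite fibre type, `w ≥ 0` log-supermodular on `α`, `P a ≥ 0` a kernel, `F a, G a ≥ 0` observables on the fibre over `a`.
If every fibre is positively associated in the normalised form `(Σ P_a F_a)(Σ P_a G_a) ≤ Σ P_a F_a G_a` and the fibre sums
`a ↦ Σ_ω P a ω F a ω`, `a ↦ Σ_ω P a ω G a ω` are monotone, then `(Σ_a w_a Σ P_a F_a)(Σ_a w_a Σ P_a G_a) ≤ (Σ_a w_a)(Σ_a w_a Σ P_a F_a G_a)`.
(Mathlib's `fkg` — the four functions theorem — applied to the fibre sums.) [cite: VandenbergHaggstromKahn2005, Lemma 2.6 (p. 10)] -/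
theorem fkg_mixture {α Ω : Type*} [DistribLattice α] [Fintype α] [Fintype Ω]
    (w : α → ℝ) (P : α → Ω → ℝ) (F G : α → Ω → ℝ)
    (hw0 : ∀ a, 0 ≤ w a) (hw : ∀ a b, w a * w b ≤ w (a ⊓ b) * w (a ⊔ b))
    (hP0 : ∀ a ω, 0 ≤ P a ω) (hF0 : ∀ a ω, 0 ≤ F a ω) (hG0 : ∀ a ω, 0 ≤ G a ω)
    (hPA : ∀ a, (∑ ω, P a ω * F a ω) * (∑ ω, P a ω * G a ω) ≤ ∑ ω, P a ω * (F a ω * G a ω))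
    (hmF : Monotone fun a => ∑ ω, P a ω * F a ω) (hmG : Monotone fun a => ∑ ω, P a ω * G a ω) :
    (∑ a, w a * ∑ ω, P a ω * F a ω) * (∑ a, w a * ∑ ω, P a ω * G a ω) ≤
      (∑ a, w a) * ∑ a, w a * ∑ ω, P a ω * (F a ω * G a ω) := by
  have hf0 : 0 ≤ fun a => ∑ ω, P a ω * F a ω :=
    fun a => Finset.sum_nonneg fun ω _ => mul_nonneg (hP0 a ω) (hF0 a ω)
  have hg0 : 0 ≤ fun a => ∑ ω, P a ω * G a ω :=
    fun a => Finset.sum_nonneg fun ω _ => mul_nonneg (hP0 a ω) (hG0 a ω)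
  have h1 := fkg (fun a => ∑ ω, P a ω * F a ω) (fun a => ∑ ω, P a ω * G a ω) w
    (fun a => hw0 a) hf0 hg0 hmF hmG hw
  have h2 : ∑ a, w a * ((∑ ω, P a ω * F a ω) * (∑ ω, P a ω * G a ω)) ≤
      ∑ a, w a * ∑ ω, P a ω * (F a ω * G a ω) :=
    Finset.sum_le_sum fun a _ => mul_le_mul_of_nonneg_left (hPA a) (hw0 a)
  have h3 : 0 ≤ ∑ a, w a := Finset.sum_nonneg fun a _ => hw0 a
  exact h1.trans (mul_le_mul_of_nonneg_left h2 h3)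

/-- **Harris' inequality on the cube `Finset ι`, normalised**: for monotone `f, g ≥ 0` and `c = 2^{-#ι}`,
`(Σ_t c f)(Σ_t c g) ≤ Σ_t c f g`.  (Mathlib's `fkg` with the constant weight.) [folklore] -/
theorem harris_cube {ι : Type*} [Fintype ι] [DecidableEq ι] (f g : Finset ι → ℝ)
    (hf0 : ∀ t, 0 ≤ f t) (hg0 : ∀ t, 0 ≤ g t) (hf : Monotone f) (hg : Monotone g) :
    (∑ t : Finset ι, ((2 : ℝ) ^ Fintype.card ι)⁻¹ * f t) * (∑ t : Finset ι, ((2 : ℝ) ^ Fintype.card ι)⁻¹ * g t) ≤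
      ∑ t : Finset ι, ((2 : ℝ) ^ Fintype.card ι)⁻¹ * (f t * g t) := by
  have h1 := fkg f g (fun _ => (1 : ℝ)) (fun _ => zero_le_one) (fun t => hf0 t) (fun t => hg0 t) hf hg
    (fun a b => by norm_num)
  simp only [one_mul, Finset.sum_const, Finset.card_univ, Fintype.card_finset, nsmul_eq_mul,
    Nat.cast_pow, Nat.cast_ofNat, mul_one] at h1
  -- h1 : (∑ f) * (∑ g) ≤ 2 ^ card ι * ∑ (f * g)
  set c : ℝ := ((2 : ℝ) ^ Fintype.card ι)⁻¹ with hc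
  have hcpos : 0 < c := by positivity
  have hc2 : c * (2 : ℝ) ^ Fintype.card ι = 1 := by
    rw [hc]; exact inv_mul_cancel₀ (by positivity)
  rw [← Finset.mul_sum, ← Finset.mul_sum, ← Finset.mul_sum]
  calc (c * ∑ t, f t) * (c * ∑ t, g t) = c * (c * ((∑ t, f t) * ∑ t, g t)) := by ring
    _ ≤ c * (c * ((2 : ℝ) ^ Fintype.card ι * ∑ t, f t * g t)) :=
        mul_le_mul_of_nonneg_left (mul_le_mul_of_nonneg_left h1 hcpos.le) hcpos.le
    _ = c * ∑ t, f t * g t := by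
        rw [← mul_assoc c ((2 : ℝ) ^ Fintype.card ι), hc2, one_mul]

/-! ### Submodularity of the edge boundary of a finite multigraph -/

section Cross
variable {V : Type*}

/-- An edge `s(u, v)` crosses `S` iff exactly one of `u, v` lies in `S`. [folklore] -/
theorem cross_mk_iff (S : Finset V) (u v : V) :
    ((∃ a ∈ s(u, v), a ∈ S) ∧ (∃ a ∈ s(u, v), a ∉ S)) ↔ ((u ∈ S ∨ v ∈ S) ∧ (u ∉ S ∨ v ∉ S)) := by
  simp only [Sym2.mem_iff, exists_eq_or_imp, exists_eq_left]

variable [DecidableEq V]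

/-- Pointwise (per edge) submodularity of the crossing indicator. [folklore] -/
theorem cross_indicator_submodular (S T : Finset V) (p : Sym2 V) :
    (if (∃ a ∈ p, a ∈ S ∪ T) ∧ (∃ a ∈ p, a ∉ S ∪ T) then 1 else 0) +
      (if (∃ a ∈ p, a ∈ S ∩ T) ∧ (∃ a ∈ p, a ∉ S ∩ T) then 1 else 0) ≤
    (if (∃ a ∈ p, a ∈ S) ∧ (∃ a ∈ p, a ∉ S) then 1 else 0) +
      (if (∃ a ∈ p, a ∈ T) ∧ (∃ a ∈ p, a ∉ T) then (1 : ℕ) else 0) := by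
  induction p using Sym2.ind with
  | h u v =>
    simp only [cross_mk_iff]
    by_cases ha : u ∈ S <;> by_cases hb : v ∈ S <;> by_cases hc : u ∈ T <;> by_cases hd : v ∈ T <;>
      simp [ha, hb, hc, hd, Finset.mem_union, Finset.mem_inter]

end Cross

variable {V : Type*} [DecidableEq V] {ι : Type*} [Fintype ι]

variable (ends : ι → Sym2 V)

/-- The edge boundary of a vertex set: edges with exactly one endpoint in `S` (loops never cross). -/
local notation "BD[" S "]" =>
  Finset.filter (fun e => (∃ v ∈ ends e, v ∈ S) ∧ (∃ v ∈ ends e, v ∉ S)) Finset.univ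

/-- **Submodularity of the edge boundary (cut function) of a finite multigraph**:
`#∂(S ∪ T) + #∂(S ∩ T) ≤ #∂S + #∂T`. [folklore] -/
theorem card_boundary_union_add_card_boundary_inter_le (S T : Finset V) :
    #BD[S ∪ T] + #BD[S ∩ T] ≤ #BD[S] + #BD[T] := by
  simp only [Finset.card_filter]
  rw [← Finset.sum_add_distrib, ← Finset.sum_add_distrib]
  exact Finset.sum_le_sum fun e _ => cross_indicator_submodular S T (ends e)

/-- The weight of a cut `S` (`x ∈ S`, `z ∉ S`): the mass `2^{-#∂S}` of the cylinder "every edge of `∂S` is blue" (zero off the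
cut lattice). [this work] -/
local notation "CW[" x ", " z ", " S "]" => (if x ∈ S ∧ z ∉ S then ((2 : ℝ) ^ (#BD[S]))⁻¹ else 0)

/-- The cut weight is nonnegative. [this work] -/
theorem cutWeight_nonneg (x z : V) (S : Finset V) : 0 ≤ CW[x, z, S] := by
  split_ifs
  · positivity
  · exact le_rfl

/-- **Log-supermodularity of the cut weight** on the distributive lattice `Finset V` (the FKG lattice condition for the mixing
measure over `x–z` cuts): `w(S) w(T) ≤ w(S ∩ T) w(S ∪ T)`. [this work] -/
theorem cutWeight_logSupermodular (x z : V) (S T : Finset V) :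
    CW[x, z, S] * CW[x, z, T] ≤ CW[x, z, S ⊓ T] * CW[x, z, S ⊔ T] := by
  show CW[x, z, S] * CW[x, z, T] ≤ CW[x, z, S ∩ T] * CW[x, z, S ∪ T]
  by_cases hS : x ∈ S ∧ z ∉ S
  · by_cases hT : x ∈ T ∧ z ∉ T
    · have hI : x ∈ S ∩ T ∧ z ∉ S ∩ T :=
        ⟨Finset.mem_inter.2 ⟨hS.1, hT.1⟩, fun h => hS.2 (Finset.mem_inter.1 h).1⟩
      have hU : x ∈ S ∪ T ∧ z ∉ S ∪ T :=
        ⟨Finset.mem_union.2 (Or.inl hS.1), fun h => (Finset.mem_union.1 h).elim hS.2 hT.2⟩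
      rw [if_pos hS, if_pos hT, if_pos hI, if_pos hU, ← mul_inv, ← mul_inv, ← pow_add, ← pow_add]
      have hsub := card_boundary_union_add_card_boundary_inter_le ends S T
      have h2 : (2 : ℝ) ^ (#BD[S ∩ T] + #BD[S ∪ T]) ≤ (2 : ℝ) ^ (#BD[S] + #BD[T]) :=
        pow_le_pow_right₀ (by norm_num) (by omega)
      exact inv_anti₀ (by positivity) h2
    · rw [if_neg hT, mul_zero]
      exact mul_nonneg (cutWeight_nonneg ends x z _) (cutWeight_nonneg ends x z _)
  · rw [if_neg hS, zero_mul]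
    exact mul_nonneg (cutWeight_nonneg ends x z _) (cutWeight_nonneg ends x z _)


/-! ### The cut-mixture theorem (FK `q = 2` red cluster, conditioned on `x ↮ z`, with a forced red cut) -/

section CutMixture

variable [Fintype V] [DecidableEq ι]

/-- The graph of the red edges `t` (as in the companion files; local notation only). -/
local notation "OG[" t "]" => SimpleGraph.fromEdgeSet (Finset.image ends t : Set (Sym2 V))
/-- The red vertex cluster of `a`. -/
local notation "CL[" t ", " a "]" => Finset.filter (fun v => SimpleGraph.Reachable (OG[t]) a v) Finset.univ
/-- The edges inside a vertex set `S` (no endpoint outside `S`). -/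
local notation "IN[" S "]" => Finset.filter (fun e => ¬ ∃ v ∈ ends e, v ∉ S) Finset.univ

omit [Fintype V] in
/-- An edge crossing `S ∩ T` or `S ∪ T` crosses `S` or `T`. [folklore] -/
theorem cross_inter_union_imp (S T : Finset V) (p : Sym2 V) :
    (((∃ a ∈ p, a ∈ S ∩ T) ∧ (∃ a ∈ p, a ∉ S ∩ T)) ∨ ((∃ a ∈ p, a ∈ S ∪ T) ∧ (∃ a ∈ p, a ∉ S ∪ T))) →
      (((∃ a ∈ p, a ∈ S) ∧ (∃ a ∈ p, a ∉ S)) ∨ ((∃ a ∈ p, a ∈ T) ∧ (∃ a ∈ p, a ∉ T))) := by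
  classical
  induction p using Sym2.ind with
  | h u v =>
    simp only [cross_mk_iff]
    by_cases ha : u ∈ S <;> by_cases hb : v ∈ S <;> by_cases hc : u ∈ T <;> by_cases hd : v ∈ T <;>
      simp [ha, hb, hc, hd, Finset.mem_union, Finset.mem_inter]

/-- Feasibility (`∂S ∩ ∂S' = ∅`) is closed under `∩` and `∪` in `S`. [this work] -/
theorem boundary_disjoint_inter_union {S T S' : Finset V} (hS : BD[S] ∩ BD[S'] = ∅) (hT : BD[T] ∩ BD[S'] = ∅) :
    BD[S ∩ T] ∩ BD[S'] = ∅ ∧ BD[S ∪ T] ∩ BD[S'] = ∅ := by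
  rw [Finset.eq_empty_iff_forall_notMem] at hS hT
  have key : ∀ e : ι,
      ((((∃ a ∈ ends e, a ∈ S ∩ T) ∧ (∃ a ∈ ends e, a ∉ S ∩ T))) ∨
        ((∃ a ∈ ends e, a ∈ S ∪ T) ∧ (∃ a ∈ ends e, a ∉ S ∪ T))) → e ∈ BD[S'] → False := by
    intro e h he'
    rcases cross_inter_union_imp S T (ends e) h with h | h
    · exact hS e (Finset.mem_inter.2 ⟨Finset.mem_filter.2 ⟨Finset.mem_univ _, h⟩, he'⟩)
    · exact hT e (Finset.mem_inter.2 ⟨Finset.mem_filter.2 ⟨Finset.mem_univ _, h⟩, he'⟩)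
  constructor
  · rw [Finset.eq_empty_iff_forall_notMem]
    intro e he
    have h1 := Finset.mem_inter.1 he
    exact key e (Or.inl (Finset.mem_filter.1 h1.1).2) h1.2
  · rw [Finset.eq_empty_iff_forall_notMem]
    intro e he
    have h1 := Finset.mem_inter.1 he
    exact key e (Or.inr (Finset.mem_filter.1 h1.1).2) h1.2

/-- The weight of a blue cut `S` compatible with the red cut `S'`: `1[x ∈ S, z ∉ S, ∂S ∩ ∂S' = ∅]·2^{-#∂S}`. [this work] -/
local notation "CWF[" x ", " z ", " S' ", " S "]" =>
  (if x ∈ S ∧ z ∉ S ∧ BD[S] ∩ BD[S'] = ∅ then ((2 : ℝ) ^ (#BD[S]))⁻¹ else 0)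

/-- The compatible cut weight is nonnegative. [this work] -/
theorem cutWeightF_nonneg (x z : V) (S' S : Finset V) : 0 ≤ CWF[x, z, S', S] := by
  split_ifs
  · positivity
  · exact le_rfl

/-- Log-supermodularity of the compatible cut weight on `Finset V`. [this work] -/
theorem cutWeightF_logSupermodular (x z : V) (S' S T : Finset V) :
    CWF[x, z, S', S] * CWF[x, z, S', T] ≤ CWF[x, z, S', S ⊓ T] * CWF[x, z, S', S ⊔ T] := by
  show CWF[x, z, S', S] * CWF[x, z, S', T] ≤ CWF[x, z, S', S ∩ T] * CWF[x, z, S', S ∪ T]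
  by_cases hS : x ∈ S ∧ z ∉ S ∧ BD[S] ∩ BD[S'] = ∅
  · by_cases hT : x ∈ T ∧ z ∉ T ∧ BD[T] ∩ BD[S'] = ∅
    · have hfeas := boundary_disjoint_inter_union ends hS.2.2 hT.2.2
      have hI : x ∈ S ∩ T ∧ z ∉ S ∩ T ∧ BD[S ∩ T] ∩ BD[S'] = ∅ :=
        ⟨Finset.mem_inter.2 ⟨hS.1, hT.1⟩, fun h => hS.2.1 (Finset.mem_inter.1 h).1, hfeas.1⟩
      have hU : x ∈ S ∪ T ∧ z ∉ S ∪ T ∧ BD[S ∪ T] ∩ BD[S'] = ∅ :=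
        ⟨Finset.mem_union.2 (Or.inl hS.1), fun h => (Finset.mem_union.1 h).elim hS.2.1 hT.2.1, hfeas.2⟩
      rw [if_pos hS, if_pos hT, if_pos hI, if_pos hU, ← mul_inv, ← mul_inv, ← pow_add, ← pow_add]
      have hsub : #BD[S ∩ T] + #BD[S ∪ T] ≤ #BD[S] + #BD[T] := by
        have h0 := card_boundary_union_add_card_boundary_inter_le ends S T
        have h1 : #BD[S ∩ T] + #BD[S ∪ T] = #BD[S ∪ T] + #BD[S ∩ T] := Nat.add_comm _ _
        rw [h1]
        convert h0 using 2 <;> (congr 1; ext e; simp only [Finset.mem_filter, Finset.mem_univ, true_and])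
      have h2 : (2 : ℝ) ^ (#BD[S ∩ T] + #BD[S ∪ T]) ≤ (2 : ℝ) ^ (#BD[S] + #BD[T]) :=
        pow_le_pow_right₀ (by norm_num) hsub
      exact inv_anti₀ (by positivity) h2
    · rw [if_neg hT, mul_zero]
      exact mul_nonneg (cutWeightF_nonneg ends x z S' _) (cutWeightF_nonneg ends x z S' _)
  · rw [if_neg hS, zero_mul]
    exact mul_nonneg (cutWeightF_nonneg ends x z S' _) (cutWeightF_nonneg ends x z S' _)

/-- **Cut-mixture theorem** (positive association of the red cluster of `x` under the `q_R = 2` measure with a forced red cut;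
cut-lattice proof of the `q = 2`, `p = ½` case of van den Berg–Häggström–Kahn's Theorem 2.1 for the cluster of one vertex).
Fix vertices `x, z`, a vertex set `S'` (the red cut: its boundary edges `∂S'` are red) and monotone `u, y ≥ 0` on vertex sets.
For a blue cut `S` (`x ∈ S`, `z ∉ S`, `∂S` blue, `∂S ∩ ∂S' = ∅`) and free colours `t ⊆ ι`, the red cluster of `x` is
`K_S(t) = cl((t ∪ ∂S') ∩ E[S], x)` (red edges inside `S`, the cut `∂S'` forced red); the measure "uniform over compatible pairs
(blue cut `S`, colouring)" is the mixture over `S` with weight `w(S) = 2^{-#∂S}` of the uniform measures on `t`, and its colouring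
marginal is `∝ 1[x ↮_red z]·2^{k(red)}·1[∂S' red]` (`2^{k(r)-2}` = number of blue cuts).  CONCLUSION (positive association of
`K` under the mixture): `(Σ_S w_S E_t u(K_S))(Σ_S w_S E_t y(K_S)) ≤ (Σ_S w_S)(Σ_S w_S E_t[u(K_S) y(K_S)])`.
Proof: `fkg_mixture` with the log-supermodular cut weight (`cutWeightF_logSupermodular`), Harris on each fibre (`harris_cube`),
and monotonicity of `K_S(t)` in `S` and `t`.  [cite: VandenbergHaggstromKahn2005, Thm. 2.1 (p. 9) and Lemma 2.6 (p. 10)] -/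
theorem cutMixture_pa (x z : V) (S' : Finset V) (u y : Finset V → ℝ) (hu : Monotone u) (hy : Monotone y)
    (hu0 : ∀ A, 0 ≤ u A) (hy0 : ∀ A, 0 ≤ y A) :
    (∑ S : Finset V, CWF[x, z, S', S] *
        ∑ t : Finset ι, ((2 : ℝ) ^ Fintype.card ι)⁻¹ * u (CL[(t ∪ BD[S']) ∩ IN[S], x])) *
      (∑ S : Finset V, CWF[x, z, S', S] *
        ∑ t : Finset ι, ((2 : ℝ) ^ Fintype.card ι)⁻¹ * y (CL[(t ∪ BD[S']) ∩ IN[S], x])) ≤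
    (∑ S : Finset V, CWF[x, z, S', S]) *
      ∑ S : Finset V, CWF[x, z, S', S] *
        ∑ t : Finset ι, ((2 : ℝ) ^ Fintype.card ι)⁻¹ *
          (u (CL[(t ∪ BD[S']) ∩ IN[S], x]) * y (CL[(t ∪ BD[S']) ∩ IN[S], x])) := by
  -- monotonicity of the fibre cluster in `t` and in `S`
  have hKt : ∀ S : Finset V, ∀ {t t' : Finset ι}, t ⊆ t' →
      CL[(t ∪ BD[S']) ∩ IN[S], x] ⊆ CL[(t' ∪ BD[S']) ∩ IN[S], x] := fun S t t' h =>
    CoefficientwiseNA.cl_mono ends (Finset.inter_subset_inter (Finset.union_subset_union h subset_rfl) subset_rfl) x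
  have hIN : ∀ {S T : Finset V}, S ⊆ T → IN[S] ⊆ IN[T] := fun {S T} h e he => by
    simp only [Finset.mem_filter, Finset.mem_univ, true_and] at he ⊢
    exact fun ⟨v, hv, hvT⟩ => he ⟨v, hv, fun hvS => hvT (h hvS)⟩
  have hKS : ∀ {S T : Finset V}, S ⊆ T → ∀ t : Finset ι,
      CL[(t ∪ BD[S']) ∩ IN[S], x] ⊆ CL[(t ∪ BD[S']) ∩ IN[T], x] := fun {S T} h t =>
    CoefficientwiseNA.cl_mono ends (Finset.inter_subset_inter subset_rfl (hIN h)) x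
  refine fkg_mixture (fun S => CWF[x, z, S', S]) (fun _ _ => ((2 : ℝ) ^ Fintype.card ι)⁻¹)
    (fun S t => u (CL[(t ∪ BD[S']) ∩ IN[S], x])) (fun S t => y (CL[(t ∪ BD[S']) ∩ IN[S], x]))
    (fun S => cutWeightF_nonneg ends x z S' S) (fun S T => cutWeightF_logSupermodular ends x z S' S T)
    (fun _ _ => by positivity) (fun S t => hu0 _) (fun S t => hy0 _) ?_ ?_ ?_
  · intro S
    exact harris_cube (fun t => u (CL[(t ∪ BD[S']) ∩ IN[S], x])) (fun t => y (CL[(t ∪ BD[S']) ∩ IN[S], x]))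
      (fun t => hu0 _) (fun t => hy0 _) (fun t t' h => hu (hKt S h)) (fun t t' h => hy (hKt S h))
  · intro S T hST
    exact Finset.sum_le_sum fun t _ => mul_le_mul_of_nonneg_left (hu (hKS hST t)) (by positivity)
  · intro S T hST
    exact Finset.sum_le_sum fun t _ => mul_le_mul_of_nonneg_left (hy (hKS hST t)) (by positivity)

end CutMixture

end CutLatticeFKG

end Summit.CriticalPhenomena.PercolationContinuityZ3.Theorems
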